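import Summits.CriticalPhenomena.CardyFormulaZ2.Theorems.CardyComplexConeParafermionToSLESixFamiliesDiamondDefsR4
import HarnessLib

/-!
# Vocabulary of line `potential-darboux-picard-diamond`, part 4 (r5, the conditional programme for S3): crux `ParafermionToSLESixFamilies` (stmt-CriticalPhenomena-11389)

Fourth definitions module of the line (lead c5, after wave 4). With S1, S2, S4′ proved (`exactPotentialTracePh_holds`, `stub_argumentPrinciple`,
`stub_identifyPotentialPh`; `potentialConformalLimit_of_closedPrecompactness : ClosedPrecompactness → PotentialConformalLimit`), the remaining
input of N + I on marked diamonds is the collar / class / non-degeneracy statement S3 `ClosedPrecompactness`, whose three conjuncts rest on inputs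
EXTERNAL to the crux (`UniformInnerEnvelope` = 11387's X1 for the collar; the route items `EdgeCoherence` (stmt-11385) and `EdgePrecompact`
(stmt-11387) for the class structure of limits; the diagonal half-plane one-arm lower bound `DiagHalfPlaneOneArmLower` ⇐
`IkhlefPonsaingFirstPassage` for non-degeneracy). This file names the three conjuncts (`ClosedCollar`, `ClosedClass`, `FreeTouchLower`) — each
VERBATIM the corresponding conjunct of `ClosedPrecompactness` under its `∀ D, IsMarkedDiamond D → ∀ Λ, IsFamily D Λ →` prefix — so that the
conditional derivations `… → ClosedCollar` etc. can be registered and landed one by one (`--supports stmt-CriticalPhenomena-11389`), and proves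
the glue `closedPrecompactness_of_parts`. NOTHING ELSE is asserted.
-/

noncomputable section

namespace Summit.CriticalPhenomena.CardyFormulaZ2.Cruxes.ParafermionToSLESixFamilies.PotentialDarbouxPicardDiamond

open scoped Topology NNReal ENNReal BigOperators
open Filter MeasureTheory Set Metric Complex
open UpperHalfPlane (upperHalfPlaneSet)
open Literature.Probability Literature.Probability.LatticeModels Literature.Probability.Percolation
open Literature.Probability.LatticeModels.DiscreteDobrushin
open Literature.Probability.RandomPlanarGeometry
open Summit.CriticalPhenomena.CardyFormulaZ2.Cruxes.ParafermionToSLESixFamilies.IicTraceFluxPairing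

/-- **S3 (a) — THE COLLAR**: asymptotic equicontinuity of the renormalised face potential `δ^{2/3}Ψ` over exact pairs on the cells of the
CLOSED diamond (boundary layer and marks included), along every admissible family of every marked diamond. Intended input:
`EdgePrecompact.QkzStripBoundaryArm.UniformInnerEnvelope` (summed radially: `δ^{2/3} Σ_{R ≤ ρ/δ} C R^{-1/3} ≤ 6 C ρ^{2/3}`) + cell-path bookkeeping. -/
def ClosedCollar : Prop :=
  ∀ (D : DobrushinDomain), IsMarkedDiamond D → ∀ (Λ : ℝ → DiscreteDobrushin), IsFamily D Λ →
    ∀ ε > (0:ℝ), ∃ η > (0:ℝ), ∀ᶠ δ in 𝓝[>] (0:ℝ), ∀ Φ Ψ : Site 2 → ℂ, IsExactPair (Λ δ) δ Φ Ψ →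
      ∀ f f' : Site 2, IsCell (Λ δ) f → IsCell (Λ δ) f' → dist (ctr δ f) (ctr δ f') < η →
        ‖(((δ ^ ((2:ℝ) / 3) : ℝ) : ℂ)) * (Ψ f - Ψ f')‖ ≤ ε

/-- **S3 (b′) — THE CLASS STRUCTURE OF LIMITS**: every subsequential compact-uniform limit mod constants of the renormalised potentials
(`IsPotentialLimit`) is holomorphic OR antiholomorphic on the carrier. Intended input: the route items `EdgeCoherence` (stmt-11385) and
`EdgePrecompact` (stmt-11387) + the mode-selection algebra (character `χ` of the `ℤ₄`-covariant limit). -/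
def ClosedClass : Prop :=
  ∀ (D : DobrushinDomain), IsMarkedDiamond D → ∀ (Λ : ℝ → DiscreteDobrushin), IsFamily D Λ →
    ∀ u : ℕ → ℝ, (∀ k, 0 < u k) → Tendsto u atTop (𝓝 0) → ∀ G : ℂ → ℂ, IsPotentialLimit D Λ u G →
      DifferentiableOn ℂ G D.carrier ∨ DifferentiableOn ℂ (fun z => (starRingEnd ℂ) (G z)) D.carrier

/-- **S3 (c) — NON-DEGENERACY (N)**: one segment of the free arc carries renormalised touch mass `≥ c₀ > 0` on its middle half, eventually.
Intended input: `FlipInvolutionReturnLaw.DiagHalfPlaneOneArmLower` (⇐ `IkhlefPonsaingFirstPassage`, landed glue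
`diagArmLower_of_ikhlefPonsaing`) + RSW/FKG gluing to `touchProb` along one free side of the diamond + the landed `touchMass_ge_card_mul`. -/
def FreeTouchLower : Prop :=
  ∀ (D : DobrushinDomain), IsMarkedDiamond D → ∀ (Λ : ℝ → DiscreteDobrushin), IsFamily D Λ →
    ∃ (p q : ℂ) (c₀ : ℝ), IsBdrySegment D p q ∧ segment ℝ p q ⊆ D.arc 1 ∧ 0 < c₀ ∧
      ∀ᶠ δ in 𝓝[>] (0:ℝ), c₀ ≤ touchMass (Λ δ) δ p q (‖q - p‖ / 4) (3 * ‖q - p‖ / 4)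

/-- Glue (registered): the three named conjuncts give S3 `ClosedPrecompactness` verbatim. -/
theorem closedPrecompactness_of_parts : ClosedCollar → ClosedClass → FreeTouchLower → ClosedPrecompactness :=
  fun ha hb hc D hD Λ hΛ => ⟨ha D hD Λ hΛ, hb D hD Λ hΛ, hc D hD Λ hΛ⟩

/-- Conversely S3 gives the three conjuncts (so the naming is faithful). -/
theorem parts_of_closedPrecompactness (h : ClosedPrecompactness) : ClosedCollar ∧ ClosedClass ∧ FreeTouchLower :=
  ⟨fun D hD Λ hΛ => (h D hD Λ hΛ).1, fun D hD Λ hΛ => (h D hD Λ hΛ).2.1, fun D hD Λ hΛ => (h D hD Λ hΛ).2.2⟩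

end Summit.CriticalPhenomena.CardyFormulaZ2.Cruxes.ParafermionToSLESixFamilies.PotentialDarbouxPicardDiamond

end
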